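import Literature.Topology.FourManifolds.LadderSlabGeometry
import Literature.Topology.FourManifolds.LevelSlide
import Mathlib.Analysis.ODE.ExistUnique
import HarnessLib

/-!
# The slide field of the ladder body: a compactly supported field on `ℝ⁴` tangent to `∂Z`, of
# unit speed in `x` across a pair of bridges, whose flow is the explicit slide

Topic `Literature/Topology/FourManifolds`; brick E3d of the constructive road (P1′) to
`Literature.Topology.FourManifolds.Trisection.isConnectedSum_of_reducing_separating`
(`ReducibleTrisectionSplitting.lean`, § Status), on top of `LadderSlabGeometry.lean` (the round
tubes of the ladder body across the slab of the `i`-th pair of bridges, the radius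
`R(x) = √(c - τx)`, the explicit slide `slideU`) and `LevelSlide.lean` (level slides; the
slide induced on a regular level by an ambient field).

* §2 `slideField i = ω χ (η⁺ X⁺ + η⁻ X⁻)` with `X^± = (1, ρ (y ∓ 1), ρ z, ρ w)`,
  `ρ = R'/R = -τ/(2R²)`, cut-offs `χ(x)` (`1` on `|x - slabCtr i| ≤ 3/8`, `0` off the slab),
  `η^±` (tube selectors in `(y ∓ 1)²`) and `ω` (`1` on the body, compact support); smooth
  (`contDiff_slideField`; `χ ρ` is smooth because `χ = 0` where `ρ` is singular).
* §3 **tangency** `dG(V) = λ (G - c)` on all of `ℝ⁴` (`fderiv_bodyG_slideField`,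
  `λ = 2 ω χ ρ (η⁺ + η⁻)`), and the **clock** `dx(V) = 1` on `∂Z` across `|x - slabCtr i| ≤ 3/8`
  (`fderiv_apply_zero_slideField`).
* §4 `exists_levelSlide`: by `LevelSlide.exists_ofAmbient`, the global flow `θ` of `V`
  restricts to a **level slide for the `x`-coordinate on `∂Z`** (the regular level manifold of
  `G` at `c`) across any `a` with `|a - slabCtr i| + δ ≤ 3/8`.
* §5 `flow_eq_slideU`: **on the inner upper tube the flow IS the explicit slide**,
  `θ (t, p) = slideU t p` (the slide is an integral curve of `X⁺ = V` there,
  `hasDerivAt_slideU`, and integral curves of the Lipschitz field `V` are unique,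
  Mathlib's `ODE_solution_unique_of_mem_Ioo`).

Everything is **proved** (explicit functions); no named fact is introduced.

## References
* J. M. Lee, *Introduction to Smooth Manifolds*, 2nd ed. (2012), Thm. 9.12, Thm. 9.16.
  [LeeSmoothManifolds2013]
* J. Milnor, *Morse theory* (1963), proof of Thm. 3.1. [Milnor1963]
-/

noncomputable section

open scoped Topology ContDiff Manifold
open Set Filter Real

namespace Literature.Topology.FourManifolds

/-- Local notation: `𝔼 n` is the model Euclidean space `EuclideanSpace ℝ (Fin n)`. -/
local notation "𝔼 " n:arg => EuclideanSpace ℝ (Fin n)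

open PlanarThickening SolidThickening Literature.Analysis.Pluripotential Metric

namespace Ladder

/-! ### §1 Calculus of `pt4`-valued maps -/

/-- A `pt4`-valued map is smooth if its components are. [folklore] -/
theorem contDiff_pt4 {E : Type*} [NormedAddCommGroup E] [NormedSpace ℝ E] {n : WithTop ℕ∞}
    {f0 f1 f2 f3 : E → ℝ} (h0 : ContDiff ℝ n f0) (h1 : ContDiff ℝ n f1) (h2 : ContDiff ℝ n f2) (h3 : ContDiff ℝ n f3) :
    ContDiff ℝ n fun x => pt4 (f0 x) (f1 x) (f2 x) (f3 x) := by
  rw [contDiff_euclidean]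
  intro j; fin_cases j
  · exact h0
  · exact h1
  · exact h2
  · exact h3

/-- A `pt4`-valued curve is differentiable with the componentwise derivative. [folklore] -/
theorem hasDerivAt_pt4 {f0 f1 f2 f3 : ℝ → ℝ} {d0 d1 d2 d3 s : ℝ} (h0 : HasDerivAt f0 d0 s)
    (h1 : HasDerivAt f1 d1 s) (h2 : HasDerivAt f2 d2 s) (h3 : HasDerivAt f3 d3 s) :
    HasDerivAt (fun s => pt4 (f0 s) (f1 s) (f2 s) (f3 s)) (pt4 d0 d1 d2 d3) s := by
  have hpi : HasDerivAt (fun s => (![f0 s, f1 s, f2 s, f3 s] : Fin 4 → ℝ)) ![d0, d1, d2, d3] s := by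
    rw [hasDerivAt_pi]
    intro j; fin_cases j
    · simpa using h0
    · simpa using h1
    · simpa using h2
    · simpa using h3
  exact ((EuclideanSpace.equiv (Fin 4) ℝ).symm : (Fin 4 → ℝ) →L[ℝ] 𝔼 4).hasFDerivAt.comp_hasDerivAt s hpi

/-- The coordinate projections of `ℝ⁴` have themselves as derivative. [folklore] -/
theorem hasFDerivAt_apply (j : Fin 4) (p : 𝔼 4) :
    HasFDerivAt (fun q : 𝔼 4 => q j) (EuclideanSpace.proj j : 𝔼 4 →L[ℝ] ℝ) p :=
  (EuclideanSpace.proj j : 𝔼 4 →L[ℝ] ℝ).hasFDerivAt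

namespace Params

variable {k : ℕ} (P : Params k)

/-! ### §2 The cut-offs and the slide field -/

/-- The logarithmic derivative of the radius, `ρ = R'/R = -τ/(2R²)`. [folklore] -/
def rho (x : ℝ) : ℝ := -P.τ / (2 * P.radSq x)

omit P in
/-- The cut-off in `x`: `1` on `|x - slabCtr i| ≤ 3/8`, `0` on `|x - slabCtr i| ≥ 1/2`. [folklore] -/
def chiX (i : ℕ) (x : ℝ) : ℝ :=
  smoothStep (-1 / 2) (-3 / 8) (x - slabCtr i) * smoothStep (-1 / 2) (-3 / 8) (slabCtr i - x)

omit P in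
/-- The tube selector, applied to `(y ∓ 1)²`: `1` for `s ≤ 3/4`, `0` for `s ≥ 49/64`. [folklore] -/
def etaSq (s : ℝ) : ℝ := smoothStep (-49 / 64) (-3 / 4) (-s)

omit P in
/-- The bound `B₀ = 1 + (3/2 (x_R + 1)² + 12)` with `‖p‖² < B₀` on the ladder body. [folklore] -/
def bsq (k : ℕ) : ℝ := 1 + (3 / 2 * (xR k + 1) ^ 2 + 12)

omit P in
/-- The cut-off at infinity: `1` on `‖p‖² ≤ B₀`, `0` on `‖p‖² ≥ B₀ + 1`. [folklore] -/
def omega (k : ℕ) (p : 𝔼 4) : ℝ := smoothStep (-(bsq k + 1)) (-bsq k) (-‖p‖ ^ 2)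

/-- `χ · ρ`, a smooth function on all of `ℝ` (`ρ` is singular only where `χ = 0`). [folklore] -/
def chiRho (i : ℕ) (x : ℝ) : ℝ := chiX i x * P.rho x

/-- The sum of the two tube selectors at height `y`. [folklore] -/
def etaSum (y : ℝ) : ℝ := etaSq ((y - 1) ^ 2) + etaSq ((y + 1) ^ 2)

/-- **The slide field** of the `i`-th pair of bridges:
`V = ω χ (η⁺ X⁺ + η⁻ X⁻)`, `X^± = (1, ρ (y ∓ 1), ρ z, ρ w)`. [folklore] -/
def slideField (i : ℕ) (p : 𝔼 4) : 𝔼 4 :=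
  pt4 (omega k p * chiX i (p 0) * etaSum (p 1))
    (omega k p * P.chiRho i (p 0) * (etaSq ((p 1 - 1) ^ 2) * (p 1 - 1) + etaSq ((p 1 + 1) ^ 2) * (p 1 + 1)))
    (omega k p * P.chiRho i (p 0) * etaSum (p 1) * p 2)
    (omega k p * P.chiRho i (p 0) * etaSum (p 1) * p 3)

/-- The multiplier `λ = 2 ω χ ρ (η⁺ + η⁻)` with `dG(V) = λ (G - c)`. [folklore] -/
def lam (i : ℕ) (p : 𝔼 4) : ℝ := 2 * omega k p * P.chiRho i (p 0) * etaSum (p 1)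

/-! #### Values of the cut-offs -/

omit P in
/-- Value / regularity of the cut-offs (elementary). [folklore] -/
theorem chiX_eq_one {i : ℕ} {x : ℝ} (hx : |x - slabCtr i| ≤ 3 / 8) : chiX i x = 1 := by
  have h := abs_le.1 hx
  unfold chiX
  rw [smoothStep_of_ge (by norm_num) (by linarith), smoothStep_of_ge (by norm_num) (by linarith), mul_one]

omit P in
/-- Value / regularity of the cut-offs (elementary). [folklore] -/
theorem chiX_eq_zero {i : ℕ} {x : ℝ} (hx : 1 / 2 ≤ |x - slabCtr i|) : chiX i x = 0 := by
  unfold chiX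
  rcases le_abs'.1 hx with h | h
  · rw [smoothStep_of_le (by norm_num) (by linarith), zero_mul]
  · rw [smoothStep_of_le (a := -1/2) (by norm_num) (x := slabCtr i - x) (by linarith), mul_zero]

omit P in
/-- Value / regularity of the cut-offs (elementary). [folklore] -/
theorem abs_lt_of_chiX_ne_zero {i : ℕ} {x : ℝ} (hx : chiX i x ≠ 0) : |x - slabCtr i| < 1 / 2 := by
  by_contra h; exact hx (chiX_eq_zero (not_lt.1 h))

omit P in
/-- Value / regularity of the cut-offs (elementary). [folklore] -/
theorem contDiff_chiX (i : ℕ) : ContDiff ℝ ∞ (chiX i) :=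
  ((contDiff_smoothStep _ _).comp (contDiff_id.sub contDiff_const)).mul
    ((contDiff_smoothStep _ _).comp (contDiff_const.sub contDiff_id))

omit P in
/-- Value / regularity of the cut-offs (elementary). [folklore] -/
theorem etaSq_eq_one {s : ℝ} (hs : s ≤ 3 / 4) : etaSq s = 1 := smoothStep_of_ge (by norm_num) (by linarith)

omit P in
/-- Value / regularity of the cut-offs (elementary). [folklore] -/
theorem etaSq_eq_zero {s : ℝ} (hs : 49 / 64 ≤ s) : etaSq s = 0 := smoothStep_of_le (by norm_num) (by linarith)

omit P in
/-- Value / regularity of the cut-offs (elementary). [folklore] -/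
theorem lt_of_etaSq_ne_zero {s : ℝ} (hs : etaSq s ≠ 0) : s < 49 / 64 := by
  by_contra h; exact hs (etaSq_eq_zero (not_lt.1 h))

omit P in
/-- Value / regularity of the cut-offs (elementary). [folklore] -/
theorem contDiff_etaSq : ContDiff ℝ ∞ etaSq := (contDiff_smoothStep _ _).comp contDiff_neg

omit P in
/-- Value / regularity of the cut-offs (elementary). [folklore] -/
theorem contDiff_etaSum : ContDiff ℝ ∞ etaSum :=
  (contDiff_etaSq.comp ((contDiff_id.sub contDiff_const).pow 2)).add
    (contDiff_etaSq.comp ((contDiff_id.add contDiff_const).pow 2))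

omit P in
/-- At most one tube selector is on: if `η((y-1)²) ≠ 0` then `η((y+1)²) = 0`. [folklore] -/
theorem etaSq_add_eq_zero_of_ne {y : ℝ} (h : etaSq ((y - 1) ^ 2) ≠ 0) : etaSq ((y + 1) ^ 2) = 0 := by
  have h1 := lt_of_etaSq_ne_zero h
  have hy : 1 / 8 < y := by nlinarith
  exact etaSq_eq_zero (by nlinarith)

omit P in
/-- Value / regularity of the cut-offs (elementary). [folklore] -/
theorem etaSq_sub_eq_zero_of_ne {y : ℝ} (h : etaSq ((y + 1) ^ 2) ≠ 0) : etaSq ((y - 1) ^ 2) = 0 := by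
  have h1 := lt_of_etaSq_ne_zero h
  have hy : y < -1 / 8 := by nlinarith
  exact etaSq_eq_zero (by nlinarith)

omit P in
/-- Value / regularity of the cut-offs (elementary). [folklore] -/
theorem omega_eq_one {p : 𝔼 4} (hp : ‖p‖ ^ 2 ≤ bsq k) : omega k p = 1 :=
  smoothStep_of_ge (by norm_num) (by linarith)

omit P in
/-- Value / regularity of the cut-offs (elementary). [folklore] -/
theorem omega_eq_zero {p : 𝔼 4} (hp : bsq k + 1 ≤ ‖p‖ ^ 2) : omega k p = 0 :=
  smoothStep_of_le (by norm_num) (by linarith)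

omit P in
/-- Value / regularity of the cut-offs (elementary). [folklore] -/
theorem contDiff_omega : ContDiff ℝ ∞ (omega k) :=
  (contDiff_smoothStep _ _).comp (contDiff_norm_sq ℝ).neg

/-- **`‖p‖² ≤ G(p) + (B₀ - 1)`** on `ℝ⁴`. [folklore] -/
theorem norm_sq_le_bodyG (p : 𝔼 4) : ‖p‖ ^ 2 ≤ P.bodyG p + (3 / 2 * (xR k + 1) ^ 2 + 12) := by
  rw [SolidThickening.norm_sq_eq, PlanarThickening.norm_sq_eq, bodyG_apply]
  have := P.norm_sq_le (proj (proj₃ p))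
  rw [ladder_pt'] at this
  simp only [proj_apply_zero, proj_apply_one, proj₃_apply_zero, proj₃_apply_one, proj₃_apply_two] at this ⊢
  linarith
where
  ladder_pt' (u : 𝔼 2) : P.ladder u = P.ladderFun (u 0) (u 1) := rfl

/-- On the ladder body, `ω = 1` (indeed `‖p‖² ≤ c + (B₀ - 1) < B₀`). [folklore] -/
theorem omega_eq_one_of_bodyG_le {p : 𝔼 4} (hp : P.bodyG p ≤ P.level) : omega k p = 1 := by
  refine omega_eq_one ?_
  have := P.norm_sq_le_bodyG p
  have hc := P.level_lt_three_quarters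
  unfold bsq; linarith

/-- **`χ ρ` is smooth on `ℝ`** (for a slab of the ladder, `i < k`). [folklore] -/
theorem contDiff_chiRho {i : ℕ} (hi : i < k) : ContDiff ℝ ∞ (P.chiRho i) := by
  rw [contDiff_iff_contDiffAt]
  intro x
  rcases lt_or_ge x (xR k + 1) with hx | hx
  · -- `R² > 1/4` near `x`: both factors smooth
    have hρ : ContDiffAt ℝ ∞ P.rho x := by
      unfold rho radSq
      refine contDiffAt_const.div (contDiffAt_const.mul (contDiffAt_const.sub (contDiffAt_const.mul contDiffAt_id))) ?_
      have := P.radSq_gt hx.le; unfold radSq at this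
      show (2 : ℝ) * (P.level - P.τ * id x) ≠ 0
      simp only [id_eq]; linarith
    exact (contDiff_chiX i).contDiffAt.mul hρ
  · -- `χ = 0` near `x`
    have hik : (i : ℝ) + 1 ≤ k := by exact_mod_cast hi
    have hev : P.chiRho i =ᶠ[nhds x] fun _ => 0 := by
      have hop : IsOpen {x : ℝ | xR k < x} := isOpen_lt continuous_const continuous_id
      filter_upwards [hop.mem_nhds (show x ∈ {x : ℝ | xR k < x} from by
        show xR k < x; linarith)] with z hz
      replace hz : xR k < z := hz
      unfold chiRho
      rw [chiX_eq_zero, zero_mul]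
      unfold slabCtr; unfold xR at hz
      rw [abs_of_pos (by linarith)]; linarith
    exact contDiffAt_const.congr_of_eventuallyEq hev

/-- **The slide field is smooth.** [folklore] -/
theorem contDiff_slideField {i : ℕ} (hi : i < k) : ContDiff ℝ ∞ (P.slideField i) := by
  have h0 : ContDiff ℝ ∞ (fun p : 𝔼 4 => p 0) := contDiff_euclidean.1 contDiff_id 0
  have h1 : ContDiff ℝ ∞ (fun p : 𝔼 4 => p 1) := contDiff_euclidean.1 contDiff_id 1
  have h2 : ContDiff ℝ ∞ (fun p : 𝔼 4 => p 2) := contDiff_euclidean.1 contDiff_id 2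
  have h3 : ContDiff ℝ ∞ (fun p : 𝔼 4 => p 3) := contDiff_euclidean.1 contDiff_id 3
  have hω : ContDiff ℝ ∞ (omega k) := contDiff_omega
  have hχ := (contDiff_chiX i).comp h0
  have hχρ := (P.contDiff_chiRho hi).comp h0
  have hη := contDiff_etaSum.comp h1
  have h1m : ContDiff ℝ ∞ (fun p : 𝔼 4 => p 1 - 1) := h1.sub contDiff_const
  have h1p : ContDiff ℝ ∞ (fun p : 𝔼 4 => p 1 + 1) := h1.add contDiff_const
  have hηp : ContDiff ℝ ∞ (fun p : 𝔼 4 => etaSq ((p 1 - 1) ^ 2)) := contDiff_etaSq.comp (h1m.pow 2)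
  have hηm : ContDiff ℝ ∞ (fun p : 𝔼 4 => etaSq ((p 1 + 1) ^ 2)) := contDiff_etaSq.comp (h1p.pow 2)
  unfold slideField
  exact contDiff_pt4 ((hω.mul hχ).mul hη)
    ((hω.mul hχρ).mul ((hηp.mul h1m).add (hηm.mul h1p)))
    (((hω.mul hχρ).mul hη).mul h2) (((hω.mul hχρ).mul hη).mul h3)

/-- The multiplier is continuous. [folklore] -/
theorem continuous_lam {i : ℕ} (hi : i < k) : Continuous (P.lam i) := by
  have h0 : Continuous (fun p : 𝔼 4 => p 0) := (contDiff_euclidean.1 contDiff_id 0 : ContDiff ℝ ∞ _).continuous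
  have h1 : Continuous (fun p : 𝔼 4 => p 1) := (contDiff_euclidean.1 contDiff_id 1 : ContDiff ℝ ∞ _).continuous
  unfold lam
  exact (((continuous_const.mul contDiff_omega.continuous).mul ((P.contDiff_chiRho hi).continuous.comp h0)).mul
    (contDiff_etaSum.continuous.comp h1))

/-- **The slide field vanishes off the ball `‖p‖² < B₀ + 1`.** [folklore] -/
theorem slideField_eq_zero_of_le {i : ℕ} {p : 𝔼 4} (hp : bsq k + 1 ≤ ‖p‖ ^ 2) : P.slideField i p = 0 := by
  unfold slideField
  rw [omega_eq_zero hp]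
  ext j; fin_cases j <;> simp

/-- The support ball. [folklore] -/
theorem slideField_eq_zero_off (i : ℕ) (p : 𝔼 4) (hp : p ∉ closedBall (0 : 𝔼 4) (Real.sqrt (bsq k + 1))) :
    P.slideField i p = 0 := by
  refine P.slideField_eq_zero_of_le ?_
  rw [mem_closedBall, dist_zero_right, not_le] at hp
  have h0 : 0 ≤ bsq k + 1 := by unfold bsq; positivity
  by_contra hlt
  rw [not_le] at hlt
  have : ‖p‖ < Real.sqrt (bsq k + 1) := by
    rw [← Real.sqrt_sq (norm_nonneg p)]; exact Real.sqrt_lt_sqrt (sq_nonneg _) hlt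
  linarith


/-! ### §3 The field is tangent to the boundary of the body: `dG(V) = λ (G - c)` -/

omit P in
/-- The coordinate projection as a continuous linear map. [folklore] -/
abbrev prj (j : Fin 4) : 𝔼 4 →L[ℝ] ℝ := EuclideanSpace.proj j

/-- The explicit bridge function `g^±(p) = τ x + (y ∓ 1)² + z² + w²` (`σ = ±1`). [folklore] -/
def gBr (σ : ℝ) (p : 𝔼 4) : ℝ := P.τ * p 0 + ((p 1 - σ) ^ 2 + p 2 ^ 2 + p 3 ^ 2)

/-- Its differential. [folklore] -/
def gBrD (σ : ℝ) (p : 𝔼 4) : 𝔼 4 →L[ℝ] ℝ :=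
  P.τ • prj 0 + (2 * (p 1 - σ)) • prj 1 + (2 * p 2) • prj 2 + (2 * p 3) • prj 3

/-- Evaluation of the differential. [folklore] -/
theorem gBrD_apply (σ : ℝ) (p v : 𝔼 4) :
    P.gBrD σ p v = P.τ * v 0 + 2 * (p 1 - σ) * v 1 + 2 * p 2 * v 2 + 2 * p 3 * v 3 := by
  simp [gBrD, prj]

/-- The bridge function has the stated differential. [folklore] -/
theorem hasFDerivAt_gBr (σ : ℝ) (p : 𝔼 4) : HasFDerivAt (P.gBr σ) (P.gBrD σ p) p := by
  have h0 := hasFDerivAt_apply 0 p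
  have h1 := hasFDerivAt_apply 1 p
  have h2 := hasFDerivAt_apply 2 p
  have h3 := hasFDerivAt_apply 3 p
  have hA : HasFDerivAt (fun q : 𝔼 4 => P.τ * q 0) (P.τ • prj 0) p := h0.const_mul P.τ
  have hB : HasFDerivAt (fun q : 𝔼 4 => (q 1 - σ) ^ 2) ((2 * (p 1 - σ)) • prj 1) p :=
    ((h1.sub_const σ).pow 2).congr_fderiv (by ext v; simp [prj])
  have hC : HasFDerivAt (fun q : 𝔼 4 => q 2 ^ 2) ((2 * p 2) • prj 2) p :=
    (h2.pow 2).congr_fderiv (by ext v; simp [prj])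
  have hD : HasFDerivAt (fun q : 𝔼 4 => q 3 ^ 2) ((2 * p 3) • prj 3) p :=
    (h3.pow 2).congr_fderiv (by ext v; simp [prj])
  exact (hA.add ((hB.add hC).add hD)).congr_fderiv (by ext v; simp [gBrD, prj]; ring)

/-- **Near a point of the open upper bridge region the body function is the bridge function.**
[folklore] -/
theorem bodyG_eventuallyEq_upper {i : ℕ} (hi : i < k) {p : 𝔼 4} (hx : |p 0 - slabCtr i| < 1 / 2)
    (hy : |p 1 - 1| < 7 / 8) : P.bodyG =ᶠ[nhds p] P.gBr 1 := by
  have h0 : Continuous (fun q : 𝔼 4 => q 0) := (contDiff_euclidean.1 contDiff_id 0 : ContDiff ℝ ∞ _).continuous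
  have h1 : Continuous (fun q : 𝔼 4 => q 1) := (contDiff_euclidean.1 contDiff_id 1 : ContDiff ℝ ∞ _).continuous
  have hop : IsOpen {q : 𝔼 4 | |q 0 - slabCtr i| < 1 / 2 ∧ |q 1 - 1| < 7 / 8} :=
    (isOpen_lt (continuous_abs.comp (h0.sub continuous_const)) continuous_const).inter
      (isOpen_lt (continuous_abs.comp (h1.sub continuous_const)) continuous_const)
  filter_upwards [hop.mem_nhds (show p ∈ {q : 𝔼 4 | _} from ⟨hx, hy⟩)] with q hq
  exact P.bodyG_eq_upper hi hq.1.le hq.2.le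

/-- The same on the lower bridge region. [folklore] -/
theorem bodyG_eventuallyEq_lower {i : ℕ} (hi : i < k) {p : 𝔼 4} (hx : |p 0 - slabCtr i| < 1 / 2)
    (hy : |p 1 + 1| < 7 / 8) : P.bodyG =ᶠ[nhds p] P.gBr (-1) := by
  have h0 : Continuous (fun q : 𝔼 4 => q 0) := (contDiff_euclidean.1 contDiff_id 0 : ContDiff ℝ ∞ _).continuous
  have h1 : Continuous (fun q : 𝔼 4 => q 1) := (contDiff_euclidean.1 contDiff_id 1 : ContDiff ℝ ∞ _).continuous
  have hop : IsOpen {q : 𝔼 4 | |q 0 - slabCtr i| < 1 / 2 ∧ |q 1 + 1| < 7 / 8} :=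
    (isOpen_lt (continuous_abs.comp (h0.sub continuous_const)) continuous_const).inter
      (isOpen_lt (continuous_abs.comp (h1.add continuous_const)) continuous_const)
  filter_upwards [hop.mem_nhds (show p ∈ {q : 𝔼 4 | _} from ⟨hx, hy⟩)] with q hq
  rw [P.bodyG_eq_lower hi hq.1.le hq.2.le]
  simp [gBr]

/-- **The tangency identity `dG(V) = λ (G - c)` on all of `ℝ⁴`.** [folklore] -/
theorem fderiv_bodyG_slideField {i : ℕ} (hi : i < k) (p : 𝔼 4) :
    fderiv ℝ P.bodyG p (P.slideField i p) = P.lam i p * (P.bodyG p - P.level) := by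
  by_cases hχ : chiX i (p 0) = 0
  · have hV : P.slideField i p = 0 := by
      unfold slideField chiRho; rw [hχ]; ext j; fin_cases j <;> simp
    rw [hV, map_zero]; unfold lam chiRho; rw [hχ]; ring
  have hx := abs_lt_of_chiX_ne_zero hχ
  obtain ⟨h1, h2, -⟩ := slab_hyps hi (x := p 0) (by unfold slabCtr at hx; exact hx.le)
  have hR : P.radSq (p 0) ≠ 0 := by linarith [P.radSq_gt (show p 0 ≤ xR k + 1 by linarith)]
  have hρ : P.rho (p 0) * (2 * P.radSq (p 0)) = -P.τ := by
    unfold rho; field_simp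
  by_cases hp : etaSq ((p 1 - 1) ^ 2) = 0
  · by_cases hm : etaSq ((p 1 + 1) ^ 2) = 0
    · -- both selectors off: `V = 0`, `λ = 0`
      have hV : P.slideField i p = 0 := by
        unfold slideField etaSum; rw [hp, hm]; ext j; fin_cases j <;> simp
      rw [hV, map_zero]; unfold lam etaSum; rw [hp, hm]; ring
    · -- lower tube
      have hy : |p 1 + 1| < 7 / 8 := by
        have := lt_of_etaSq_ne_zero hm
        exact abs_lt_of_sq_lt_sq (by norm_num; linarith) (by norm_num)
      rw [(P.bodyG_eventuallyEq_lower hi hx hy).fderiv_eq, (P.hasFDerivAt_gBr (-1) p).fderiv, gBrD_apply,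
        P.bodyG_eq_lower hi hx.le hy.le]
      unfold slideField lam etaSum chiRho
      simp only [pt4_apply_zero, pt4_apply_one, pt4_apply_two, pt4_apply_three, hp, zero_mul, zero_add]
      unfold radSq at hρ hR
      set ρ := P.rho (p 0)
      rw [sub_neg_eq_add]
      linear_combination (omega k p * chiX i (p 0) * etaSq ((p 1 + 1) ^ 2)) * hρ
  · -- upper tube
    have hm : etaSq ((p 1 + 1) ^ 2) = 0 := etaSq_add_eq_zero_of_ne hp
    have hy : |p 1 - 1| < 7 / 8 := by
      have := lt_of_etaSq_ne_zero hp
      exact abs_lt_of_sq_lt_sq (by norm_num; linarith) (by norm_num)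
    rw [(P.bodyG_eventuallyEq_upper hi hx hy).fderiv_eq, (P.hasFDerivAt_gBr 1 p).fderiv, gBrD_apply,
      P.bodyG_eq_upper hi hx.le hy.le]
    unfold slideField lam etaSum chiRho
    simp only [pt4_apply_zero, pt4_apply_one, pt4_apply_two, pt4_apply_three, hm, zero_mul, add_zero]
    unfold radSq at hρ hR
    set ρ := P.rho (p 0)
    linear_combination (omega k p * chiX i (p 0) * etaSq ((p 1 - 1) ^ 2)) * hρ

/-- **The clock `dx(V) = 1` on the boundary of the body across `|x - slabCtr i| ≤ 3/8`.**
[folklore] -/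
theorem fderiv_apply_zero_slideField {i : ℕ} (hi : i < k) {p : 𝔼 4} (hG : P.bodyG p = P.level)
    (hx : |p 0 - slabCtr i| ≤ 3 / 8) : fderiv ℝ (fun q : 𝔼 4 => q 0) p (P.slideField i p) = 1 := by
  rw [(hasFDerivAt_apply 0 p).fderiv]
  show P.slideField i p 0 = 1
  unfold slideField
  rw [pt4_apply_zero, P.omega_eq_one_of_bodyG_le hG.le, chiX_eq_one hx, one_mul, one_mul]
  have hx' : |p 0 - slabCtr i| ≤ 1 / 2 := by linarith
  obtain ⟨h1, h2, -⟩ := slab_hyps hi (x := p 0) (by unfold slabCtr at hx'; exact hx')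
  have hR := P.radSq_gt (show p 0 ≤ xR k + 1 by linarith)
  have hc := P.level_lt_three_quarters
  unfold etaSum
  rcases le_or_gt 0 (p 1) with hy0 | hy0
  · have h := (P.bodyG_eq_iff_upper hi hx' hy0).1 hG
    have hs : (p 1 - 1) ^ 2 ≤ 3 / 4 := by unfold radSq at hR; nlinarith [sq_nonneg (p 2), sq_nonneg (p 3), P.τ_pos]
    rw [etaSq_eq_one hs, etaSq_eq_zero (by nlinarith)]; ring
  · have h := (P.bodyG_eq_iff_lower hi hx' hy0.le).1 hG
    have hs : (p 1 + 1) ^ 2 ≤ 3 / 4 := by unfold radSq at hR; nlinarith [sq_nonneg (p 2), sq_nonneg (p 3), P.τ_pos]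
    rw [etaSq_eq_one hs, etaSq_eq_zero (by nlinarith)]; ring


/-! ### §4 The level slide of a pair of bridges -/

/-- The level `c` of the body function is regular. [folklore] -/
theorem isRegularLevel_bodyG : IsRegularLevel (𝓡 4) P.bodyG P.level :=
  P.isHoledDiscMorseFunction.isRegularLevel₄

/-- The slide field has compact support. [folklore] -/
theorem hasCompactSupport_slideField (i : ℕ) : HasCompactSupport (P.slideField i) :=
  HasCompactSupport.intro (isCompact_closedBall (0 : 𝔼 4) (Real.sqrt (bsq k + 1)))
    (P.slideField_eq_zero_off i)

/-- **The level slide of the `i`-th pair of bridges.**  For every `a`, `δ > 0` with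
`|a - slabCtr i| + δ ≤ 3/8`, the global flow `θ` of the slide field `V` (a smooth complete flow of
`ℝ⁴` by diffeomorphisms preserving the ladder body and its boundary) restricts to a level slide
`U` for the `x`-coordinate across `a`, of half-width `δ`, on the boundary `∂Z = {G = c}` of the
ladder body (as the regular level manifold `RegularLevel P.isRegularLevel_bodyG`).
[cite: LeeSmoothManifolds2013, Thm. 9.16 and Thm. 9.12; Milnor1963, proof of Thm. 3.1] -/
theorem exists_levelSlide {i : ℕ} (hi : i < k) {a δ : ℝ} (hδ : 0 < δ) (haδ : |a - slabCtr i| + δ ≤ 3 / 8) :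
    ∃ (θ : ℝ × 𝔼 4 → 𝔼 4)
      (U : LevelSlide 2 ((fun p : 𝔼 4 => p 0) ∘ RegularLevel.incl P.isRegularLevel_bodyG) a),
      ContDiff ℝ ∞ θ ∧ (∀ x, θ (0, x) = x) ∧ (∀ t s x, θ (t, θ (s, x)) = θ (t + s, x)) ∧
      (∀ x t, HasDerivAt (fun t => θ (t, x)) (P.slideField i (θ (t, x))) t) ∧
      (∀ x, P.slideField i x = 0 → ∀ t, θ (t, x) = x) ∧ U.δ = δ ∧
      ∀ p t, RegularLevel.incl P.isRegularLevel_bodyG (U.fl p t) = θ (t, RegularLevel.incl P.isRegularLevel_bodyG p) := by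
  have hS : ContDiff ℝ ∞ (fun p : 𝔼 4 => p 0) := contDiff_euclidean.1 contDiff_id 0
  refine LevelSlide.exists_ofAmbient P.isRegularLevel_bodyG (P.contDiff_slideField hi)
    (isCompact_closedBall (0 : 𝔼 4) (Real.sqrt (bsq k + 1))) (P.slideField_eq_zero_off i)
    (P.continuous_lam hi) (P.fderiv_bodyG_slideField hi) hS hδ fun x hx hxa => ?_
  refine P.fderiv_apply_zero_slideField hi hx ?_
  have h1 : |x 0 - a| < δ := by rw [abs_lt]; constructor <;> linarith [hxa.1, hxa.2]
  have := abs_sub_le (x 0) a (slabCtr i)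
  linarith

/-! ### §5 On the inner tubes the flow is the explicit slide -/

/-- The explicit upper field `X⁺ = (1, ρ (y - 1), ρ z, ρ w)`. [folklore] -/
def xUp (p : 𝔼 4) : 𝔼 4 := pt4 1 (P.rho (p 0) * (p 1 - 1)) (P.rho (p 0) * p 2) (P.rho (p 0) * p 3)

/-- **On the closed upper tube over `|x - slabCtr i| ≤ 3/8` the slide field is `X⁺`.** [folklore] -/
theorem slideField_eq_xUp {i : ℕ} (hi : i < k) {q : 𝔼 4} (hG : P.bodyG q ≤ P.level)
    (hx : |q 0 - slabCtr i| ≤ 3 / 8) (hy : 0 ≤ q 1) : P.slideField i q = P.xUp q := by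
  have hx' : |q 0 - slabCtr i| ≤ 1 / 2 := by linarith
  obtain ⟨h1, h2, -⟩ := slab_hyps hi (x := q 0) (by unfold slabCtr at hx'; exact hx')
  have hR := P.radSq_gt (show q 0 ≤ xR k + 1 by linarith)
  have hc := P.level_lt_three_quarters
  have h := (P.bodyG_le_iff_upper hi hx' hy).1 hG
  have hs : (q 1 - 1) ^ 2 ≤ 3 / 4 := by unfold radSq at hR; nlinarith [sq_nonneg (q 2), sq_nonneg (q 3), P.τ_pos]
  have hp : etaSq ((q 1 - 1) ^ 2) = 1 := etaSq_eq_one hs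
  have hm : etaSq ((q 1 + 1) ^ 2) = 0 := etaSq_eq_zero (by nlinarith)
  unfold slideField xUp etaSum chiRho
  rw [P.omega_eq_one_of_bodyG_le hG, chiX_eq_one hx, hp, hm]
  ext j; fin_cases j <;> simp

/-- The derivative of the radius: `R' = ρ R`. [folklore] -/
theorem hasDerivAt_rad {x : ℝ} (hx : x ≤ xR k + 1) : HasDerivAt P.rad (P.rho x * P.rad x) x := by
  have hR := P.radSq_gt hx
  have h1 : HasDerivAt P.radSq (-P.τ) x := by
    unfold radSq
    simpa using ((hasDerivAt_id x).const_mul P.τ).const_sub P.level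
  have h2 := h1.sqrt (by linarith)
  have hsq : Real.sqrt (P.radSq x) ^ 2 = P.radSq x := Real.sq_sqrt (by linarith)
  have hpos : 0 < Real.sqrt (P.radSq x) := Real.sqrt_pos.2 (by linarith)
  have e : -P.τ / (2 * Real.sqrt (P.radSq x)) = P.rho x * P.rad x := by
    unfold rho rad
    rw [div_mul_eq_mul_div, div_eq_div_iff (by positivity) (by positivity)]
    have : -P.τ * Real.sqrt (P.radSq x) * (2 * Real.sqrt (P.radSq x)) = -P.τ * (2 * Real.sqrt (P.radSq x) ^ 2) := by ring
    rw [this, hsq]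
  rw [← e]; exact h2

/-- **The explicit slide is an integral curve of `X⁺`**: `d/ds slide_s p = X⁺ (slide_s p)`
(over `x, x + s ≤ x_R + 1`). [folklore] -/
theorem hasDerivAt_slideU {p : 𝔼 4} (hx : p 0 ≤ xR k + 1) {s : ℝ} (hs : p 0 + s < xR k + 1) :
    HasDerivAt (fun s => P.slideU s p) (P.xUp (P.slideU s p)) s := by
  have hR0 := (P.rad_pos hx).ne'
  have hr : HasDerivAt (fun s => P.rad (p 0 + s)) (P.rho (p 0 + s) * P.rad (p 0 + s)) s := by
    have h := (P.hasDerivAt_rad hs.le).comp s ((hasDerivAt_id s).const_add (p 0))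
    rw [mul_one] at h
    exact h
  have hq : HasDerivAt (fun s => P.rad (p 0 + s) / P.rad (p 0)) (P.rho (p 0 + s) * P.rad (p 0 + s) / P.rad (p 0)) s :=
    hr.div_const _
  unfold slideU xUp
  refine hasDerivAt_pt4 ((hasDerivAt_id s).const_add (p 0)) ?_ ?_ ?_
  · have h := (hq.const_mul (p 1 - 1)).const_add 1
    simp only [pt4_apply_zero, pt4_apply_one]
    have e : P.rho (p 0 + s) * (1 + (p 1 - 1) * (P.rad (p 0 + s) / P.rad (p 0)) - 1) =
        (p 1 - 1) * (P.rho (p 0 + s) * P.rad (p 0 + s) / P.rad (p 0)) := by ring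
    rw [e]; exact h
  · have h := hq.const_mul (p 2)
    simp only [pt4_apply_zero, pt4_apply_two]
    have e : P.rho (p 0 + s) * (p 2 * (P.rad (p 0 + s) / P.rad (p 0))) =
        p 2 * (P.rho (p 0 + s) * P.rad (p 0 + s) / P.rad (p 0)) := by ring
    rw [e]; exact h
  · have h := hq.const_mul (p 3)
    simp only [pt4_apply_zero, pt4_apply_three]
    have e : P.rho (p 0 + s) * (p 3 * (P.rad (p 0 + s) / P.rad (p 0))) =
        p 3 * (P.rho (p 0 + s) * P.rad (p 0 + s) / P.rad (p 0)) := by ring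
    rw [e]; exact h

/-- **A flow of the slide field is the explicit slide on the inner upper tube**: if `p ∈ Z`,
`y ≥ 0`, `|x - slabCtr i| < 3/8` and `|x + t - slabCtr i| < 3/8`, then `θ (t, p) = slide_t p`
(uniqueness of integral curves of the Lipschitz field `V`, which equals `X⁺` along the slide).
[cite: LeeSmoothManifolds2013, Thm. 9.12] -/
theorem flow_eq_slideU {i : ℕ} (hi : i < k) {θ : ℝ × 𝔼 4 → 𝔼 4} (h0 : ∀ x, θ (0, x) = x)
    (hint : ∀ x t, HasDerivAt (fun t => θ (t, x)) (P.slideField i (θ (t, x))) t)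
    {p : 𝔼 4} (hG : P.bodyG p ≤ P.level) (hy : 0 ≤ p 1) (hx : |p 0 - slabCtr i| < 3 / 8)
    {t : ℝ} (ht : |p 0 + t - slabCtr i| < 3 / 8) : θ (t, p) = P.slideU t p := by
  obtain ⟨C, hC⟩ := (P.contDiff_slideField hi).lipschitzWith_of_hasCompactSupport
    (P.hasCompactSupport_slideField i) (by simp)
  have hxabs := abs_lt.1 hx
  have htabs := abs_lt.1 ht
  -- the time interval on which the slid point stays over `|x - slabCtr i| < 3/8`
  set lo := slabCtr i - 3 / 8 - p 0
  set hi' := slabCtr i + 3 / 8 - p 0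
  have h0mem : (0 : ℝ) ∈ Ioo lo hi' := ⟨by simp only [lo]; linarith, by simp only [hi']; linarith⟩
  have htmem : t ∈ Ioo lo hi' := ⟨by simp only [lo]; linarith, by simp only [hi']; linarith⟩
  have hx12 : |p 0 - slabCtr i| ≤ 1 / 2 := by linarith [hx.le]
  obtain ⟨h1, h2, -⟩ := slab_hyps hi (x := p 0) (by unfold slabCtr at hx12; exact hx12)
  have hxR : p 0 ≤ xR k + 1 := by linarith
  have hv : (p 1 - 1) ^ 2 + p 2 ^ 2 + p 3 ^ 2 ≤ P.radSq (p 0) := by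
    have := (P.bodyG_le_iff_upper hi hx12 hy).1 hG; unfold radSq; linarith
  -- along the slide the field is `X⁺`
  have hslide : ∀ s ∈ Ioo lo hi', P.slideField i (P.slideU s p) = P.xUp (P.slideU s p) := by
    intro s hs
    have hs' : |p 0 + s - slabCtr i| < 3 / 8 := by
      rw [abs_lt]; constructor
      · simp only [lo] at hs; linarith [hs.1]
      · simp only [hi'] at hs; linarith [hs.2]
    have hxs12 : |p 0 + s - slabCtr i| ≤ 1 / 2 := by linarith [hs'.le]
    have hsub := P.bodyG_slideU_sub hi hx12 hxs12 hv
    obtain ⟨h1s, h2s, -⟩ := slab_hyps hi (x := p 0 + s) (by unfold slabCtr at hxs12; exact hxs12)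
    have hRs := P.radSq_gt (show p 0 + s ≤ xR k + 1 by linarith)
    have hR := P.radSq_gt hxR
    have hGs : P.bodyG (P.slideU s p) ≤ P.level := by
      have : 0 ≤ P.radSq (p 0 + s) / P.radSq (p 0) := div_nonneg (by linarith) (by linarith)
      nlinarith
    refine P.slideField_eq_xUp hi hGs (by simpa using hs'.le) ?_
    -- `y' = 1 + (y - 1) R(x+s)/R(x) ≥ 1 - R(x+s) > 0`
    show 0 ≤ 1 + (p 1 - 1) * (P.rad (p 0 + s) / P.rad (p 0))
    have hr0 := P.rad_pos hxR
    have hrs := P.rad_pos (show p 0 + s ≤ xR k + 1 by linarith)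
    have hrslt := P.rad_lt (by linarith) (show p 0 + s ≤ xR k + 1 by linarith)
    have hy1 : |p 1 - 1| ≤ P.rad (p 0) := by
      refine abs_le_of_sq_le_sq' ?_ hr0.le |> fun h => abs_le.2 h
      rw [P.rad_sq hxR]; nlinarith [sq_nonneg (p 2), sq_nonneg (p 3)]
    have : |(p 1 - 1) * (P.rad (p 0 + s) / P.rad (p 0))| ≤ P.rad (p 0 + s) := by
      rw [abs_mul, abs_div, abs_of_pos hr0, abs_of_pos hrs]
      calc |p 1 - 1| * (P.rad (p 0 + s) / P.rad (p 0)) ≤ P.rad (p 0) * (P.rad (p 0 + s) / P.rad (p 0)) := by gcongr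
        _ = P.rad (p 0 + s) := by field_simp
    have := neg_abs_le ((p 1 - 1) * (P.rad (p 0 + s) / P.rad (p 0)))
    linarith
  have key := ODE_solution_unique_of_mem_Ioo (v := fun _ => P.slideField i) (s := fun _ => univ) (K := C)
    (f := fun s => θ (s, p)) (g := fun s => P.slideU s p) (t₀ := 0) (a := lo) (b := hi')
    (fun _ _ => hC.lipschitzOnWith) h0mem
    (fun s _ => ⟨hint p s, mem_univ _⟩)
    (fun s hs => ⟨?_, mem_univ _⟩) (by rw [h0, P.slideU_zero hxR])
  · exact key htmem
  · rw [hslide s hs]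
    refine P.hasDerivAt_slideU hxR ?_
    simp only [hi'] at hs
    unfold slabCtr at hs; unfold xR
    have hik : (i : ℝ) + 1 ≤ k := by exact_mod_cast hi
    linarith [hs.2]

end Params

end Ladder

end Literature.Topology.FourManifolds
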